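import Summits.QuantumFields.YangMills.Theorems.F4SubCurvatureDoorShortRootRigidityPlanarExponentialMoments
import Mathlib
import HarnessLib

/-!
# LINE g20-A «angular type» — step S2 packaged: the frame Laplace–Fourier transform on the NARROW forward tube (aperture `c`)

Crux `F4SubCurvatureDoor.ShortRootRigidity` ⟨stmt-QuantumFields-23035⟩, skeleton `Cruxes/ShortRootRigidity/Lines/angular_type.lean`, card §Hardest stub
(plan for (C) `PlanarSpectralCone`), step S2 in the form step S3 consumes.  For `k ∈ InPlanarClass` with chart constant `c > 0`
(`…PlanarExponentialMomentsRegistered.planarExponentialMoments` ✓) and ANY Laplace–Fourier representing measure `μ` of the frame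
(`…PlanarLaplaceFourier.exists_planarLF` ✓): the transform `F(ζ, σ) = ∫ e^{-ζE} cos(σp) dμ(E, p)` is holomorphic on the narrow tube
`{(ζ, σ) ∈ ℂ² : |Im σ| < c·Re ζ}` (dominated holomorphic parameter integral, the dominating functions being the exponential moments of S2),
its real points are `F(t, b) = k(t, b)` (`t > 0`), and `‖F(ζ, σ)‖ ≤ 2M` for every bound `M` of `|k|` on `{‖y'‖ ≥ c·Re ζ}`
(`planarNarrowTube`).  The target (C) is the same statement with aperture `1` (and the cone majorant): the passage `c → 1` is step S3 (XL, OPEN).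

HONEST LABEL: S2 only, as a helper; (C), (A), stub 4, ⟨23035⟩, ⟨23125⟩, R2d and the Yang–Mills mass gap remain OPEN; no summit is proved by a line.
-/

noncomputable section

open MeasureTheory Filter Topology Set Metric Complex
open scoped BigOperators NNReal ENNReal

namespace Summit.QuantumFields.YangMills.Theorems.F4SubCurvatureDoorPlanarNarrowTube

open Summit.QuantumFields.YangMills.Theorems.F4SubCurvatureDoorSliceDensityRegistered (E2)
open Summit.QuantumFields.YangMills.Theorems.F4SubCurvatureDoorSliceInClassRegistered (InPlanarClass)
open Summit.QuantumFields.YangMills.Theorems.F4SubCurvatureDoorPlanarLaplaceFourier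
open Summit.QuantumFields.YangMills.Theorems.F4SubCurvatureDoorPlanarFrameTimeHolomorphyRegistered (mk2)
open Summit.QuantumFields.YangMills.Theorems.F4SubCurvatureDoorPlanarExponentialMomentsRegistered (planarExponentialMoments_of)

/-- `‖cos w‖ ≤ (e^{Im w} + e^{-Im w})/2` (from `2 cos w = e^{iw} + e^{-iw}`). -/
theorem norm_cos_le (w : ℂ) : ‖Complex.cos w‖ ≤ (Real.exp w.im + Real.exp (-w.im)) / 2 := by
  have h : Complex.cos w = (Complex.exp (w * I) + Complex.exp (-w * I)) / 2 := by
    rw [← Complex.two_cos]; ring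
  rw [h, norm_div, Complex.norm_two, div_le_div_iff_of_pos_right two_pos]
  refine (norm_add_le _ _).trans (le_of_eq ?_)
  rw [Complex.norm_exp, Complex.norm_exp]
  simp only [mul_re, I_re, mul_zero, I_im, mul_one, zero_sub, neg_mul, neg_re, neg_neg]
  ring

/-- The kernel `e^{-ζE} cos(σp)` is dominated by exponential moments: for `E ≥ 0`, `Re ζ ≥ t₁`, `|Im σ| ≤ β₁`:
`‖e^{-ζE} cos(σp)‖ ≤ e^{-t₁E + β₁p} + e^{-t₁E - β₁p}`. -/
theorem norm_kernel_le {ζ σ : ℂ} {t₁ β₁ E p : ℝ} (hE : 0 ≤ E) (hζ : t₁ ≤ ζ.re) (hσ : |σ.im| ≤ β₁) :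
    ‖Complex.exp (-(ζ * (E : ℂ))) * Complex.cos (σ * (p : ℂ))‖
      ≤ Real.exp (-(t₁ * E) + β₁ * p) + Real.exp (-(t₁ * E) + -β₁ * p) := by
  rw [norm_mul, Complex.norm_exp]
  have hre : (-(ζ * (E : ℂ))).re = -(ζ.re * E) := by simp [Complex.mul_re]
  rw [hre]
  have him : (σ * (p : ℂ)).im = σ.im * p := by simp [Complex.mul_im]
  have hcos := norm_cos_le (σ * (p : ℂ))
  rw [him] at hcos
  have h1 : Real.exp (-(ζ.re * E)) ≤ Real.exp (-(t₁ * E)) := Real.exp_le_exp.2 (by nlinarith)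
  have h2 : Real.exp (σ.im * p) + Real.exp (-(σ.im * p)) ≤ 2 * (Real.exp (β₁ * p) + Real.exp (-β₁ * p)) := by
    rcases le_or_gt 0 p with hp | hp
    · have ha : Real.exp (σ.im * p) ≤ Real.exp (β₁ * p) :=
        Real.exp_le_exp.2 (mul_le_mul_of_nonneg_right (le_trans (le_abs_self _) hσ) hp)
      have hb : Real.exp (-(σ.im * p)) ≤ Real.exp (β₁ * p) :=
        Real.exp_le_exp.2 (by nlinarith [neg_abs_le σ.im, abs_nonneg σ.im])
      nlinarith [Real.exp_pos (-β₁ * p)]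
    · have ha : Real.exp (σ.im * p) ≤ Real.exp (-β₁ * p) :=
        Real.exp_le_exp.2 (by nlinarith [neg_abs_le σ.im])
      have hb : Real.exp (-(σ.im * p)) ≤ Real.exp (-β₁ * p) :=
        Real.exp_le_exp.2 (by nlinarith [le_abs_self σ.im])
      nlinarith [Real.exp_pos (β₁ * p)]
  calc Real.exp (-(ζ.re * E)) * ‖Complex.cos (σ * (p : ℂ))‖
      ≤ Real.exp (-(t₁ * E)) * ((Real.exp (σ.im * p) + Real.exp (-(σ.im * p))) / 2) :=
        mul_le_mul h1 hcos (norm_nonneg _) (Real.exp_pos _).le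
    _ ≤ Real.exp (-(t₁ * E)) * (Real.exp (β₁ * p) + Real.exp (-β₁ * p)) :=
        mul_le_mul_of_nonneg_left (by linarith) (Real.exp_pos _).le
    _ = Real.exp (-(t₁ * E) + β₁ * p) + Real.exp (-(t₁ * E) + -β₁ * p) := by
        rw [mul_add, ← Real.exp_add, ← Real.exp_add]

/-- **S2 · the frame transform on the narrow forward tube.**  For `k ∈ InPlanarClass` there is `c > 0` such that for every Laplace–Fourier
representing measure `μ` of the frame, `F(ζ, σ) = ∫ e^{-ζE} cos(σp) dμ` is holomorphic on `{|Im σ| < c·Re ζ}`, has real points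
`F(t, b) = k(t, b)` (`t > 0`), and `‖F(ζ, σ)‖ ≤ 2M` for every bound `M` of `|k|` on `{‖y'‖ ≥ c·Re ζ}`. -/
theorem planarNarrowTube (k : E2 → ℝ) (hk : InPlanarClass k) :
    ∃ c : ℝ, 0 < c ∧ ∀ μ : Measure (ℝ × ℝ), μ (Iio 0 ×ˢ univ) = 0 →
      (∀ t : ℝ, 0 < t → Integrable (fun z : ℝ × ℝ => Real.exp (-(t * z.1))) μ ∧
        ∀ x : ℝ, k (mk2 t x) = ∫ z, Real.exp (-(z.1 * t)) * Real.cos (z.2 * x) ∂μ) →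
      DifferentiableOn ℂ (fun q : ℂ × ℂ => ∫ z : ℝ × ℝ, Complex.exp (-(q.1 * (z.1 : ℂ))) * Complex.cos (q.2 * (z.2 : ℂ)) ∂μ)
          {q : ℂ × ℂ | |q.2.im| < c * q.1.re} ∧
      (∀ t b : ℝ, 0 < t →
          (∫ z : ℝ × ℝ, Complex.exp (-((t : ℂ) * (z.1 : ℂ))) * Complex.cos ((b : ℂ) * (z.2 : ℂ)) ∂μ) = ((k (mk2 t b) : ℝ) : ℂ)) ∧
      ∀ q : ℂ × ℂ, |q.2.im| < c * q.1.re → ∀ M : ℝ, (∀ y' : E2, c * q.1.re ≤ ‖y'‖ → |k y'| ≤ M) →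
          ‖∫ z : ℝ × ℝ, Complex.exp (-(q.1 * (z.1 : ℂ))) * Complex.cos (q.2 * (z.2 : ℂ)) ∂μ‖ ≤ 2 * M := by
  obtain ⟨c, hc, hmom⟩ := planarExponentialMoments_of k hk
  refine ⟨c, hc, fun μ hμ0 hμ => ?_⟩
  have hae : ∀ᵐ z ∂μ, 0 ≤ z.1 := ae_energy_nonneg hμ0
  have hmomμ := hmom μ hμ0 hμ
  -- measurability / differentiability of the kernel
  have hKc : ∀ q : ℂ × ℂ, Continuous fun z : ℝ × ℝ => Complex.exp (-(q.1 * (z.1 : ℂ))) * Complex.cos (q.2 * (z.2 : ℂ)) :=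
    fun q => by fun_prop
  have hKd : ∀ z : ℝ × ℝ, Differentiable ℂ fun q : ℂ × ℂ => Complex.exp (-(q.1 * (z.1 : ℂ))) * Complex.cos (q.2 * (z.2 : ℂ)) :=
    fun z => by fun_prop
  -- positivity inside the tube
  have htube_pos : ∀ q : ℂ × ℂ, |q.2.im| < c * q.1.re → 0 < q.1.re := by
    intro q hq
    rcases le_or_gt q.1.re 0 with h | h
    · have : c * q.1.re ≤ 0 := mul_nonpos_of_nonneg_of_nonpos hc.le h
      linarith [abs_nonneg q.2.im]
    · exact h
  refine ⟨?_, ?_, ?_⟩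
  · -- holomorphy on the narrow tube
    refine Literature.Analysis.Complex.differentiableOn_integral_of_dominated (fun q _ => (hKc q).aestronglyMeasurable)
      (Eventually.of_forall fun z => (hKd z).differentiableOn) ?_
    intro q₀ hq₀
    have hq₀' : |q₀.2.im| < c * q₀.1.re := hq₀
    have ht₀ : 0 < q₀.1.re := htube_pos q₀ hq₀'
    -- the margin
    set R : ℝ := (c * q₀.1.re - |q₀.2.im|) / (2 * (1 + c)) with hR
    have hRpos : 0 < R := by rw [hR]; exact div_pos (by linarith) (by positivity)
    have hR1 : R * (1 + c) < c * q₀.1.re - |q₀.2.im| := by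
      rw [hR, div_mul_eq_mul_div, div_lt_iff₀ (by positivity)]
      nlinarith [abs_nonneg q₀.2.im]
    set t₁ : ℝ := q₀.1.re - R with ht₁
    set β₁ : ℝ := |q₀.2.im| + R with hβ₁
    have ht₁pos : 0 < t₁ := by
      rw [ht₁]
      have : R < q₀.1.re := by
        have h1 : R ≤ R * (1 + c) := le_mul_of_one_le_right hRpos.le (by linarith)
        have h2 : c * q₀.1.re ≤ q₀.1.re * c := by linarith
        nlinarith [abs_nonneg q₀.2.im, mul_pos hc ht₀]
      linarith
    have hβ₁t₁ : |β₁| < c * t₁ := by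
      rw [hβ₁, ht₁, abs_of_nonneg (by positivity)]
      nlinarith
    have hβ₁t₁' : |-β₁| < c * t₁ := by rw [abs_neg]; exact hβ₁t₁
    obtain ⟨hIp, -⟩ := hmomμ t₁ β₁ ht₁pos hβ₁t₁
    obtain ⟨hIm, -⟩ := hmomμ t₁ (-β₁) ht₁pos hβ₁t₁'
    refine ⟨R, hRpos, ?_, fun z => Real.exp (-(t₁ * z.1) + β₁ * z.2) + Real.exp (-(t₁ * z.1) + -β₁ * z.2), hIp.add hIm, ?_⟩
    · -- the ball stays in the tube
      intro q hq
      rw [mem_ball, Prod.dist_eq, max_lt_iff] at hq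
      have h1 : |q.1.re - q₀.1.re| < R := lt_of_le_of_lt (by
        simpa using Complex.abs_re_le_norm (q.1 - q₀.1)) (by rw [← dist_eq_norm]; exact hq.1)
      have h2 : |q.2.im - q₀.2.im| < R := lt_of_le_of_lt (by
        simpa using Complex.abs_im_le_norm (q.2 - q₀.2)) (by rw [← dist_eq_norm]; exact hq.2)
      show |q.2.im| < c * q.1.re
      rw [abs_lt] at h1 h2
      have h3 := abs_add_le (q.2.im - q₀.2.im) q₀.2.im
      rw [sub_add_cancel] at h3
      have h4 : |q.2.im - q₀.2.im| < R := abs_lt.2 ⟨h2.1, h2.2⟩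
      nlinarith
    · -- domination
      filter_upwards [hae] with z hz q hq
      rw [mem_ball, Prod.dist_eq, max_lt_iff] at hq
      have h1 : |q.1.re - q₀.1.re| < R := lt_of_le_of_lt (by
        simpa using Complex.abs_re_le_norm (q.1 - q₀.1)) (by rw [← dist_eq_norm]; exact hq.1)
      have h2 : |q.2.im - q₀.2.im| < R := lt_of_le_of_lt (by
        simpa using Complex.abs_im_le_norm (q.2 - q₀.2)) (by rw [← dist_eq_norm]; exact hq.2)
      rw [abs_lt] at h1 h2
      refine norm_kernel_le hz ?_ ?_
      · rw [ht₁]; linarith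
      · rw [hβ₁]
        have h3 := abs_add_le (q.2.im - q₀.2.im) q₀.2.im
        rw [sub_add_cancel] at h3
        have h4 : |q.2.im - q₀.2.im| < R := abs_lt.2 ⟨h2.1, h2.2⟩
        linarith
  · -- real points
    intro t b ht
    rw [(hμ t ht).2 b, ← integral_complex_ofReal]
    refine integral_congr_ae (Eventually.of_forall fun z => ?_)
    dsimp only
    rw [show -((t : ℂ) * (z.1 : ℂ)) = ((-(z.1 * t) : ℝ) : ℂ) by push_cast; ring,
      show (b : ℂ) * (z.2 : ℂ) = ((z.2 * b : ℝ) : ℂ) by push_cast; ring,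
      ← Complex.ofReal_exp, ← Complex.ofReal_cos]
    push_cast; ring
  · -- the bound
    intro q hq M hM
    have ht : 0 < q.1.re := htube_pos q hq
    have hb : |q.2.im| < c * q.1.re := hq
    have hb' : |-q.2.im| < c * q.1.re := by rw [abs_neg]; exact hb
    obtain ⟨hIp, hlep⟩ := hmomμ q.1.re q.2.im ht hb
    obtain ⟨hIm, hlem⟩ := hmomμ q.1.re (-q.2.im) ht hb'
    have hbound : ∀ᵐ z ∂μ, ‖Complex.exp (-(q.1 * (z.1 : ℂ))) * Complex.cos (q.2 * (z.2 : ℂ))‖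
        ≤ (Real.exp (-(q.1.re * z.1) + q.2.im * z.2) + Real.exp (-(q.1.re * z.1) + -q.2.im * z.2)) / 2 := by
      filter_upwards [hae] with z hz
      rw [norm_mul, Complex.norm_exp]
      have hre : (-(q.1 * (z.1 : ℂ))).re = -(q.1.re * z.1) := by simp [Complex.mul_re]
      have him : (q.2 * (z.2 : ℂ)).im = q.2.im * z.2 := by simp [Complex.mul_im]
      have hcos := norm_cos_le (q.2 * (z.2 : ℂ))
      rw [him] at hcos
      rw [hre]
      calc Real.exp (-(q.1.re * z.1)) * ‖Complex.cos (q.2 * (z.2 : ℂ))‖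
          ≤ Real.exp (-(q.1.re * z.1)) * ((Real.exp (q.2.im * z.2) + Real.exp (-(q.2.im * z.2))) / 2) :=
            mul_le_mul_of_nonneg_left hcos (Real.exp_pos _).le
        _ = _ := by rw [neg_mul, mul_div_assoc', mul_add, ← Real.exp_add, ← Real.exp_add]
    refine (norm_integral_le_of_norm_le ((hIp.add hIm).div_const 2) hbound).trans ?_
    rw [integral_div, integral_add' hIp hIm]
    linarith [hlep M hM, hlem M hM]

end Summit.QuantumFields.YangMills.Theorems.F4SubCurvatureDoorPlanarNarrowTube

end
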